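import Mathlib
import HarnessLib

/-!
# Venture HSemireg — the stabiliser pairing of a product of two exact components

HONEST FRAMING. Lean leaf for the computation cell `pub-hsemireg` (theory seat th-3 gen 30; file of
record `run/shared/lean/pub/pub-hsemireg/theory/TH3-W3-EVIDENCE-AUDIT.md` v1.5 §8.1, 2026-08-24).
In the fibre test for reduced-point complexes the transversal components of a class at a base
direction are `x`-anticommutators `{x, a} = x ∘ a + a ∘ x` (`x = u(s)` odd, `a` an odd potential), and
the law (EX×) asked whether the cross product of two classes pairs to zero, under the supertrace,
with every degree-0 operator `ζ` commuting with `x` (the infinitesimal stabiliser of `x`). The one-line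
identity that converts this pairing into a CURVATURE pairing — the step behind «(EX×) at a direction ⟺
t-5's same-index law» (§8.1) — is kernel-checked HERE: with `σ` the parity operator
(supertrace of `X` = `trace (σ * X)`), if `σ * x = -(x * σ)` and `ζ * x = x * ζ` then
`trace (σ * (ζ * {x,a} * {x,b})) = trace (σ * (ζ * a * [x*x, b]))`, where `x * x` is (half) the curvature
of the pencil at the base direction; in particular the pairing vanishes on the flat stratum.
The classes, the potentials and the model are NOT formalised; (EX×) itself is FALSE in general
(§8.2 of the file of record); nothing here bears on HC, HC_CM or HC_AV.
-/

namespace Summit.Ventures.HSemireg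

open LinearMap

variable {F : Type*} [Field F]
variable {U : Type*} [AddCommGroup U] [Module F U]

/-- **Odd cyclicity of the supertrace.** If the parity operator `σ` anticommutes with `x`
(`σ * x = -(x * σ)`), then for every `P`: `trace (σ * P * x) = - trace (σ * x * P)` — moving an odd
factor from the back to the front of a supertrace costs a sign. [folklore] -/
theorem trace_parity_mul_odd_cycle (σ x P : Module.End F U) (hσx : σ * x = -(x * σ)) :
    LinearMap.trace F U (σ * P * x) = -LinearMap.trace F U (σ * x * P) := by
  have h1 : LinearMap.trace F U (σ * P * x) = LinearMap.trace F U (x * (σ * P)) :=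
    LinearMap.trace_mul_comm F (σ * P) x
  have hxσ : x * σ = -(σ * x) := by rw [hσx, neg_neg]
  rw [h1, ← mul_assoc, hxσ, neg_mul, map_neg]

/-- **Stabiliser pairing of a product of two `x`-exact components** (TH3-W3-EVIDENCE-AUDIT §8.1).
For the parity operator `σ` with `σ * x = -(x * σ)` (`x` odd) and a degree-0 operator `ζ` commuting with
`x`, and arbitrary `a`, `b`:
`trace (σ * (ζ * (x*a + a*x) * (x*b + b*x))) = trace (σ * (ζ * a * (x*x*b - b*(x*x))))`.
Proof: of the four words `ζxaxb`, `ζxabx`, `ζaxxb`, `ζaxbx`, the first and the last cancel under the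
supertrace by odd cyclicity and `ζx = xζ`, the second becomes `-ζx²ab`, and `str(ζx²ab) = str(ζabx²)`
by cyclicity (`x²` commutes with `σ` and with `ζ`). [folklore] -/
theorem supertrace_stabiliser_anticomm_mul_anticomm (σ ζ x a b : Module.End F U)
    (hσx : σ * x = -(x * σ)) (hζx : ζ * x = x * ζ) :
    LinearMap.trace F U (σ * (ζ * (x * a + a * x) * (x * b + b * x)))
      = LinearMap.trace F U (σ * (ζ * a * (x * x * b - b * (x * x)))) := by
  have hxζ : x * ζ = ζ * x := hζx.symm
  have hxσ : x * σ = -(σ * x) := by rw [hσx, neg_neg]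
  -- the four words
  have expand : σ * (ζ * (x * a + a * x) * (x * b + b * x))
      = σ * ζ * x * a * x * b + σ * (ζ * x * a * b) * x + σ * ζ * a * x * x * b
        + σ * (ζ * a * x * b) * x := by
    noncomm_ring
  -- word 4 = - word 1 under the supertrace
  have h4 : LinearMap.trace F U (σ * (ζ * a * x * b) * x)
      = -LinearMap.trace F U (σ * ζ * x * a * x * b) := by
    rw [trace_parity_mul_odd_cycle σ x (ζ * a * x * b) hσx]
    have e : σ * x * (ζ * a * x * b) = σ * ζ * x * a * x * b := by
      calc σ * x * (ζ * a * x * b) = σ * (x * ζ) * a * x * b := by noncomm_ring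
        _ = σ * (ζ * x) * a * x * b := by rw [hxζ]
        _ = σ * ζ * x * a * x * b := by noncomm_ring
    rw [e]
  -- word 2 = - str(ζ x x a b)
  have h2 : LinearMap.trace F U (σ * (ζ * x * a * b) * x)
      = -LinearMap.trace F U (σ * ζ * x * x * a * b) := by
    rw [trace_parity_mul_odd_cycle σ x (ζ * x * a * b) hσx]
    have e : σ * x * (ζ * x * a * b) = σ * ζ * x * x * a * b := by
      calc σ * x * (ζ * x * a * b) = σ * (x * ζ) * x * a * b := by noncomm_ring
        _ = σ * (ζ * x) * x * a * b := by rw [hxζ]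
        _ = σ * ζ * x * x * a * b := by noncomm_ring
    rw [e]
  -- str(ζ x x a b) = str(ζ a b x x)
  have h23 : LinearMap.trace F U (σ * ζ * x * x * a * b)
      = LinearMap.trace F U (σ * ζ * a * b * (x * x)) := by
    have c1 : LinearMap.trace F U (σ * ζ * a * b * (x * x))
        = LinearMap.trace F U ((x * x) * (σ * ζ * a * b)) :=
      LinearMap.trace_mul_comm F (σ * ζ * a * b) (x * x)
    have e : (x * x) * (σ * ζ * a * b) = σ * ζ * x * x * a * b := by
      calc (x * x) * (σ * ζ * a * b) = x * (x * σ) * ζ * a * b := by noncomm_ring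
        _ = x * (-(σ * x)) * ζ * a * b := by rw [hxσ]
        _ = -((x * σ) * x * ζ * a * b) := by noncomm_ring
        _ = -((-(σ * x)) * x * ζ * a * b) := by rw [hxσ]
        _ = σ * x * (x * ζ) * a * b := by noncomm_ring
        _ = σ * x * (ζ * x) * a * b := by rw [hxζ]
        _ = σ * (x * ζ) * x * a * b := by noncomm_ring
        _ = σ * (ζ * x) * x * a * b := by rw [hxζ]
        _ = σ * ζ * x * x * a * b := by noncomm_ring
    rw [c1, e]
  have rhs : σ * (ζ * a * (x * x * b - b * (x * x)))
      = σ * ζ * a * x * x * b - σ * ζ * a * b * (x * x) := by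
    noncomm_ring
  rw [expand, map_add, map_add, map_add, h4, h2, h23, rhs, map_sub]
  ring

end Summit.Ventures.HSemireg
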